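import Summits.QuantumFields.YangMills.Theorems.PoincareLipschitzSphereMapSmallRangeEnergyDecay
import HarnessLib

/-!
# Line «poincare_lipschitz» on crux `HistoryTailL` (stmt-QuantumFields-19936), route crux `BlockLipschitzL` (stmt-QuantumFields-23533), K2 organ of record `hReg` (LOC-REG-MIN) —
# FLAT SHADOW «SMALL-RANGE DISCRETE REGULARITY INTO A SPHERE», FILE 3: THE MORREY ITERATION AND THE HÖLDER RADIUS LAW
# `‖u(x₀+e_μ) − u(x₀)‖ ≤ C_d·ω·R^{−1∕2}` for one-site-optimal sphere-valued lattice maps with range in a ball of radius `ω ≤ ω₀(d)` on `Q_{2R+2}(x₀)`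

Cell `ym3-torus` (YM ladder rung R3 = continuum SU(2) Yang–Mills on the three-torus — a RUNG, NOT the Clay problem: not d = 4, not infinite volume, not a
mass gap); width seat `ym3-torus-px7` gen 5 (LEAD ym-ust-19936-w1 g8 04:37:48Z «SMALL-RANGE — GO»; my LOCATE `LOCATE-SMALL-RANGE-S3-px7g5.md` §1 (δ), §4).  THEOREMS ONLY
(def-free) over FILE 1 ✓`PoincareLipschitzSphereMapSmallRangeCaccioppoli` (top-scale energy `E(Q_ρ) ≲ ρ^{d−2}ω²`) and FILE 2 ✓`PoincareLipschitzSphereMapSmallRangeEnergyDecay`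
(`E(Q_ρ) ≤ (4A_d((ρ+1)∕r)^d + (8A_d+4)·2ω)·E(Q_{r+1})`); `--supports stmt-QuantumFields-19936`.  Nothing here proves `hReg`, the per-bond charts, a stub, `BlockLipschitzL`,
`HistoryTailL` or a summit statement; nothing twisted ∕ covariant.

THE ARGUMENT (Giaquinta–Giusti's direct method, lattice form; LOCATE §1 (δ)).  Fix the integer ratio `m = m_d ≥ 8A_d·2^d + 3` and the range threshold
`ω₀ = m^{−(d−1)}∕(4(8A_d+4))`.  At the radii `n_k = m^k − 1` FILE 2 reads `E(Q_{n_k}(x₀)) ≤ m^{−(d−1)}·E(Q_{n_{k+1}}(x₀))` (`((ρ+1)∕r)^d ≤ (2∕m)^d`,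
`4A_d(2∕m)^d ≤ ½m^{−(d−1)}`, `(8A_d+4)·2ω ≤ ½m^{−(d−1)}`), so `E(Q_0(x₀)) ≤ m^{−(d−1)K}·E(Q_{m^K−1}(x₀)) ≤ m^{−(d−1)K}·200d·5^d·m^{K(d−2)}·ω² = 200d5^d·ω²·m^{−K}`
by FILE 1 at the top scale; and `‖u(x₀+e_μ) − u(x₀)‖² ≤ E(Q_0(x₀))` (the one-point box).  For a general radius `R` take `m^K ≤ R < m^{K+1}`.
The exponent `½` is a choice (any `β < 1` costs a larger `m_d`); the LIPSCHITZ law `C·ω∕R` ((ε) of the LOCATE: gradient-Campanato over ✓`gradient_excess_decay`) is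
the sequel, not this file.

* §1 `geometric_iter` (if `E k ≤ θ·E(k+1)` for `k < K` then `E 0 ≤ θ^K·E K`), `pow_ratio_le` (`(m^k∕(m^{k+1} − 2))^d ≤ (2∕m)^d`).
* §2 ★★ `smallRange_energy_at_centre_le` — `Σ_μ‖u(x₀+e_μ) − u(x₀)‖² ≤ 200d·5^d·ω²·m^{−K}` under the hypotheses on `Q_{2m^K+1}(x₀)`.
* §3 ★★★ `smallRange_holder_law` — the title, general `R ≥ 1`.
[folklore] ([Giaquinta1984] Ch. III Lemma 2.1 p.86 (the iteration), Ch. VI §1 Thm 1.1 steps I–II, §3 Thm 3.2; Hildebrandt–Kaul–Widman, Acta Math. 138 (1977)).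
-/

set_option autoImplicit false

noncomputable section

open scoped BigOperators InnerProductSpace
open Finset

namespace Summit.QuantumFields.YangMills.Theorems.PoincareLipschitzSphereMapSmallRangeHolder

open Literature.MathematicalPhysics.QuantumFieldTheory.Balaban1983to89
open B4Eq19LatticeOperators
open Summit.QuantumFields.YangMills.Theorems.PoincareLipschitzSphereMapSmallRangeCaccioppoli (smallRange_caccioppoli)
open Summit.QuantumFields.YangMills.Theorems.PoincareLipschitzSphereMapSmallRangeEnergyDecay (smallRange_energy_decay)

variable {d : ℕ} {V : Type*} [NormedAddCommGroup V] [InnerProductSpace ℝ V]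

/-! ## §1 Real-variable bookkeeping -/

/-- Downward geometric iteration: `E k ≤ θ·E(k+1)` for `k < K` (`θ ≥ 0`) gives `E 0 ≤ θ^K·E K`. [folklore] [cite: Giaquinta1984, Ch. III Lemma 2.1 p.86] -/
theorem geometric_iter (E : ℕ → ℝ) {θ : ℝ} (hθ : 0 ≤ θ) (K : ℕ) (hstep : ∀ k, k < K → E k ≤ θ * E (k + 1)) : E 0 ≤ θ ^ K * E K := by
  induction K with
  | zero => simp
  | succ K ih =>
    have h1 : E 0 ≤ θ ^ K * E K := ih fun k hk => hstep k (Nat.lt_succ_of_lt hk)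
    have h2 : E K ≤ θ * E (K + 1) := hstep K (Nat.lt_succ_self K)
    calc E 0 ≤ θ ^ K * E K := h1
      _ ≤ θ ^ K * (θ * E (K + 1)) := mul_le_mul_of_nonneg_left h2 (pow_nonneg hθ K)
      _ = θ ^ (K + 1) * E (K + 1) := by rw [pow_succ]; ring

/-- The ratio of consecutive radii: for `m ≥ 4`, `(m^k ∕ (m^{k+1} − 2))^d ≤ (2∕m)^d`. [folklore] -/
theorem pow_ratio_le {m : ℕ} (hm : 4 ≤ m) (k d : ℕ) :
    (((m : ℝ) ^ k) / ((m : ℝ) ^ (k + 1) - 2)) ^ d ≤ (2 / (m : ℝ)) ^ d := by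
  have hmR : (4 : ℝ) ≤ m := by exact_mod_cast hm
  have hmk : (1 : ℝ) ≤ (m : ℝ) ^ k := one_le_pow₀ (by linarith)
  have hden : 0 < (m : ℝ) ^ (k + 1) - 2 := by rw [pow_succ]; nlinarith
  apply pow_le_pow_left₀ (div_nonneg (by positivity) hden.le)
  rw [div_le_div_iff₀ hden (by linarith), pow_succ]
  nlinarith

/-! ## §2 The energy at the centre after `K` steps -/

/-- ★★ **THE ENERGY AT THE CENTRE BOND AFTER `K` DECAY STEPS.**  `V` finite-dimensional, `d ≥ 1`; `A := A_d = 2^d(1+56d)^d(8(d+1))^{d+1}`, an integer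
`m ≥ 8A·2^d + 4`, the range threshold `ω ≤ m^{−(d−1)}∕(4(8A+4))` (and `ω ≤ 1`); if `‖u‖ = 1` and `‖u − p‖ ≤ ω` on `Q_{2m^K+1}(x₀)` (`‖p‖ = 1`) and `u` is one-site
optimal on `Q_{2m^K}(x₀)`, then `Σ_μ ‖u(x₀+e_μ) − u(x₀)‖² ≤ 200·d·5^d·ω²·m^{−K}` — the Morrey decay `E(Q_{m^k−1}) ≤ m^{−(d−1)(K−k)}E(Q_{m^K−1})` read at `k = 0`.
[folklore] [cite: Giaquinta1984, Ch. VI §1 Thm 1.1 (steps I–II) pp.128–131, Ch. III Lemma 2.1 p.86] -/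
theorem smallRange_energy_at_centre_le [FiniteDimensional ℝ V] (hd : 1 ≤ d) (u : Zd d → V) (p : V) (hp : ‖p‖ = 1) (x₀ : Zd d) {m : ℕ}
    (hm : 8 * ((2 : ℝ) ^ d * (1 + 56 * d) ^ d * (8 * ((d : ℝ) + 1)) ^ (d + 1)) * 2 ^ d + 4 ≤ m) (K : ℕ) {ω : ℝ} (hω0 : 0 ≤ ω) (hω1 : ω ≤ 1)
    (hωsmall : ω ≤ ((m : ℝ) ^ (d - 1))⁻¹ / (4 * (8 * ((2 : ℝ) ^ d * (1 + 56 * d) ^ d * (8 * ((d : ℝ) + 1)) ^ (d + 1)) + 4)))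
    (hu1 : ∀ y ∈ box x₀ (2 * (m : ℤ) ^ K + 1), ‖u y‖ = 1) (hω : ∀ y ∈ box x₀ (2 * (m : ℤ) ^ K + 1), ‖u y - p‖ ≤ ω)
    (hopt : ∀ y ∈ box x₀ (2 * (m : ℤ) ^ K),
      ‖∑ μ, (u (y + unitVec μ) + u (y - unitVec μ))‖ • u y = ∑ μ, (u (y + unitVec μ) + u (y - unitVec μ))) :
    ∑ μ, ‖u (x₀ + unitVec μ) - u x₀‖ ^ 2 ≤ 200 * d * (5 : ℝ) ^ d * ω ^ 2 * ((m : ℝ) ^ K)⁻¹ := by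
  classical
  set A : ℝ := (2 : ℝ) ^ d * (1 + 56 * d) ^ d * (8 * ((d : ℝ) + 1)) ^ (d + 1) with hA
  have hA1 : 1 ≤ A := by
    rw [hA]
    have h1 : (1 : ℝ) ≤ (2 : ℝ) ^ d := one_le_pow₀ (by norm_num)
    have h2 : (1 : ℝ) ≤ (1 + 56 * (d : ℝ)) ^ d := one_le_pow₀ (by have : (0:ℝ) ≤ d := Nat.cast_nonneg d; linarith)
    have h3 : (1 : ℝ) ≤ (8 * ((d : ℝ) + 1)) ^ (d + 1) := one_le_pow₀ (by have : (0:ℝ) ≤ d := Nat.cast_nonneg d; linarith)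
    calc (1 : ℝ) = 1 * 1 * 1 := by ring
      _ ≤ (2 : ℝ) ^ d * (1 + 56 * (d : ℝ)) ^ d * (8 * ((d : ℝ) + 1)) ^ (d + 1) := by gcongr
  have hA0 : 0 ≤ A := by linarith
  have h2d : (1 : ℝ) ≤ (2 : ℝ) ^ d := one_le_pow₀ (by norm_num)
  have hm4R : (4 : ℝ) ≤ m := by nlinarith
  have hm4 : 4 ≤ m := by exact_mod_cast hm4R
  have hm0 : (0 : ℝ) < m := by linarith
  have hm1 : (1 : ℝ) ≤ m := by linarith
  -- energies at the radii `m^k − 1`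
  set E : ℕ → ℝ := fun k => ∑ y ∈ box x₀ ((m : ℤ) ^ k - 1), ∑ μ, ‖u (y + unitVec μ) - u y‖ ^ 2 with hE
  have hE0 : ∀ k, 0 ≤ E k := fun k => Finset.sum_nonneg fun _ _ => Finset.sum_nonneg fun _ _ => sq_nonneg _
  -- the decay factor
  set θ : ℝ := ((m : ℝ) ^ (d - 1))⁻¹ with hθ
  have hθ0 : 0 < θ := by positivity
  -- the step, `k < K`
  have hmZ : ((m : ℤ) : ℝ) = (m : ℝ) := by norm_cast
  have hstep : ∀ k, k < K → E k ≤ θ * E (k + 1) := by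
    intro k hk
    -- FILE 2 at `ρ = m^k − 1`, `r = m^{k+1} − 2`
    have hmk1 : (1 : ℤ) ≤ (m : ℤ) ^ k := one_le_pow₀ (by exact_mod_cast (show 1 ≤ m by omega))
    have hmk1' : (4 : ℤ) ≤ (m : ℤ) ^ (k + 1) := by
      calc (4 : ℤ) ≤ (m : ℤ) := by exact_mod_cast hm4
        _ = (m : ℤ) ^ 1 := (pow_one _).symm
        _ ≤ (m : ℤ) ^ (k + 1) := pow_le_pow_right₀ (by linarith) (by omega)
    have hρr : (m : ℤ) ^ k - 1 + 1 ≤ (m : ℤ) ^ (k + 1) - 2 := by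
      have : (m : ℤ) ^ k * 4 ≤ (m : ℤ) ^ k * m := mul_le_mul_of_nonneg_left (by exact_mod_cast hm4) (by linarith)
      rw [pow_succ]; nlinarith
    -- the big box of FILE 2 (`Q_{r+2} = Q_{m^{k+1}}`) sits inside the hypotheses' boxes
    have hKk : (m : ℤ) ^ (k + 1) ≤ (m : ℤ) ^ K := pow_le_pow_right₀ (by linarith) (by omega)
    have hsub2 : box x₀ ((m : ℤ) ^ (k + 1) - 2 + 2) ⊆ box x₀ (2 * (m : ℤ) ^ K + 1) := box_mono x₀ (by linarith)
    have hsub1 : box x₀ ((m : ℤ) ^ (k + 1) - 2 + 1) ⊆ box x₀ (2 * (m : ℤ) ^ K) := box_mono x₀ (by linarith)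
    have hdec := smallRange_energy_decay hd u p x₀ (ρ := (m : ℤ) ^ k - 1) (r := (m : ℤ) ^ (k + 1) - 2) (by linarith) (by linarith) hρr hω0
      (fun y hy => hu1 y (hsub2 hy)) (fun y hy => hω y (hsub2 hy)) (fun y hy => hopt y (hsub1 hy))
    rw [← hA] at hdec
    have er : ((m : ℤ) ^ (k + 1) - 2 + 1 : ℤ) = (m : ℤ) ^ (k + 1) - 1 := by ring
    rw [er] at hdec
    -- the factor is `≤ θ`
    have hq : ((((((m : ℤ) ^ k - 1 : ℤ) : ℝ)) + 1) / ((((m : ℤ) ^ (k + 1) - 2 : ℤ) : ℝ))) ^ d ≤ (2 / (m : ℝ)) ^ d := by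
      have e1 : ((((m : ℤ) ^ k - 1 : ℤ) : ℝ)) + 1 = (m : ℝ) ^ k := by push_cast; ring
      have e2 : ((((m : ℤ) ^ (k + 1) - 2 : ℤ) : ℝ)) = (m : ℝ) ^ (k + 1) - 2 := by push_cast; ring
      rw [e1, e2]; exact pow_ratio_le hm4 k d
    have hfac : 4 * A * ((((((m : ℤ) ^ k - 1 : ℤ) : ℝ)) + 1) / ((((m : ℤ) ^ (k + 1) - 2 : ℤ) : ℝ))) ^ d + (8 * A + 4) * (2 * ω) ≤ θ := by
      -- `4A(2/m)^d ≤ θ/2` and `(8A+4)·2ω ≤ θ/2`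
      have t1 : 4 * A * (2 / (m : ℝ)) ^ d ≤ θ / 2 := by
        -- `4A·2^d∕(m^{d-1}·m) ≤ 1∕(2m^{d-1})  ⟸  8A·2^d ≤ m`
        set M1 : ℝ := (m : ℝ) ^ (d - 1) with hM1
        have hM1pos : 0 < M1 := by positivity
        have hmd : (m : ℝ) ^ d = M1 * m := by rw [hM1, ← pow_succ]; congr 1; omega
        rw [hθ, div_pow, hmd, show M1⁻¹ / 2 = 1 / (2 * M1) by field_simp, show 4 * A * (2 ^ d / (M1 * m)) = (4 * A * 2 ^ d) / (M1 * m) by ring,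
          div_le_div_iff₀ (by positivity) (by positivity), one_mul]
        have h8 : 8 * A * 2 ^ d ≤ (m : ℝ) := by linarith
        calc 4 * A * 2 ^ d * (2 * M1) = (8 * A * 2 ^ d) * M1 := by ring
          _ ≤ (m : ℝ) * M1 := mul_le_mul_of_nonneg_right h8 hM1pos.le
          _ = M1 * m := mul_comm _ _
      have t2 : (8 * A + 4) * (2 * ω) ≤ θ / 2 := by
        have hpos : (0 : ℝ) < 8 * A + 4 := by positivity
        calc (8 * A + 4) * (2 * ω) ≤ (8 * A + 4) * (2 * (θ / (4 * (8 * A + 4)))) := by gcongr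
          _ = θ / 2 := by field_simp; ring
      have t3 := mul_le_mul_of_nonneg_left hq (by positivity : (0 : ℝ) ≤ 4 * A)
      linarith
    calc E k ≤ (4 * A * ((((((m : ℤ) ^ k - 1 : ℤ) : ℝ)) + 1) / ((((m : ℤ) ^ (k + 1) - 2 : ℤ) : ℝ))) ^ d + (8 * A + 4) * (2 * ω)) * E (k + 1) := hdec
      _ ≤ θ * E (k + 1) := mul_le_mul_of_nonneg_right hfac (hE0 (k + 1))
  -- the iteration
  have hiter := geometric_iter E hθ0.le K hstep
  -- the top scale by FILE 1 (`ρ = m^K − 1`, `s = m^K`)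
  have hmK1 : (1 : ℤ) ≤ (m : ℤ) ^ K := one_le_pow₀ (by exact_mod_cast (show 1 ≤ m by omega))
  have htop := smallRange_caccioppoli hd u p hp x₀ (ρ := (m : ℤ) ^ K - 1) (s := (m : ℤ) ^ K) (by linarith) hmK1 hω0 hω1
    (fun y hy => hu1 y (by rw [show (m : ℤ) ^ K - 1 + (m : ℤ) ^ K + 2 = 2 * (m : ℤ) ^ K + 1 by ring] at hy; exact hy))
    (fun y hy => hω y (by rw [show (m : ℤ) ^ K - 1 + (m : ℤ) ^ K + 2 = 2 * (m : ℤ) ^ K + 1 by ring] at hy; exact hy))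
    (fun y hy => hopt y (by rw [show (m : ℤ) ^ K - 1 + (m : ℤ) ^ K + 1 = 2 * (m : ℤ) ^ K by ring] at hy; exact hy))
  -- letters for the top scale
  set M : ℝ := (m : ℝ) ^ K with hM
  have hM1 : (1 : ℝ) ≤ M := one_le_pow₀ hm1
  have hM0 : (0 : ℝ) < M := by positivity
  have htop' : E K ≤ 200 * d * ω ^ 2 * ((5 : ℝ) ^ d * M ^ d) / M ^ 2 := by
    have e1 : (((2 * ((m : ℤ) ^ K - 1 + (m : ℤ) ^ K + 1) + 1 : ℤ) : ℝ)) = 4 * M + 1 := by rw [hM]; push_cast; ring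
    have e2 : ((((m : ℤ) ^ K : ℤ) : ℝ)) = M := by rw [hM]; push_cast; ring
    rw [hE]; dsimp only
    refine htop.trans ?_
    rw [e1, e2]
    have h5 : (4 * M + 1) ^ d ≤ (5 : ℝ) ^ d * M ^ d := by
      rw [← mul_pow]; exact pow_le_pow_left₀ (by positivity) (by linarith) d
    exact div_le_div_of_nonneg_right (mul_le_mul_of_nonneg_left h5 (by positivity)) (by positivity)
  -- `θ^K = (M^{d−1})⁻¹` and the product `θ^K·M^d∕M² = M⁻¹`
  have hθK : θ ^ K = (M ^ (d - 1))⁻¹ := by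
    rw [hθ, hM, inv_pow, ← pow_mul, ← pow_mul, mul_comm]
  have hprod : θ ^ K * (200 * d * ω ^ 2 * ((5 : ℝ) ^ d * M ^ d) / M ^ 2) = 200 * d * (5 : ℝ) ^ d * ω ^ 2 * M⁻¹ := by
    have hpow : M ^ d = M ^ (d - 1) * M := by rw [← pow_succ]; congr 1; omega
    have hMd1 : (0 : ℝ) < M ^ (d - 1) := by positivity
    rw [hθK, hpow]
    field_simp
  -- assemble: the one-point box
  have hbox0 : ∑ μ, ‖u (x₀ + unitVec μ) - u x₀‖ ^ 2 ≤ E 0 := by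
    rw [hE]; dsimp only
    rw [pow_zero, sub_self]
    exact Finset.single_le_sum (f := fun y => ∑ μ, ‖u (y + unitVec μ) - u y‖ ^ 2) (fun _ _ => Finset.sum_nonneg fun _ _ => sq_nonneg _)
      (self_mem_box x₀ le_rfl)
  calc ∑ μ, ‖u (x₀ + unitVec μ) - u x₀‖ ^ 2 ≤ E 0 := hbox0
    _ ≤ θ ^ K * E K := hiter
    _ ≤ θ ^ K * (200 * d * ω ^ 2 * ((5 : ℝ) ^ d * M ^ d) / M ^ 2) := mul_le_mul_of_nonneg_left htop' (pow_nonneg hθ0.le K)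
    _ = 200 * d * (5 : ℝ) ^ d * ω ^ 2 * M⁻¹ := hprod


/-! ## §3 ★★★ The Hölder radius law at a general radius -/

/-- ★★★ **THE HÖLDER RADIUS LAW FOR SMALL-RANGE ONE-SITE-OPTIMAL SPHERE-VALUED LATTICE MAPS (exponent `½`, squared form).**  `V` finite-dimensional, `d ≥ 1`.
There are `ω₀ = ω₀(d) > 0` and `C = C(d) > 0` such that for every integer radius `R ≥ 1`, every `u : ℤ^d → V` with `‖u‖ = 1` and `‖u − p‖ ≤ ω` on `Q_{2R+1}(x₀)`
(`‖p‖ = 1`, `0 ≤ ω ≤ ω₀`), one-site optimal (`‖N‖·u = N`) on `Q_{2R}(x₀)`, and every axis `μ`: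
`‖u(x₀ + e_μ) − u(x₀)‖² ≤ C·ω²∕R` — i.e. `‖∇u(x₀)‖ ≤ √C·ω·R^{−1∕2}`: the flat∕untwisted lattice shadow of the organ's radius law, with the HÖLDER exponent `½` in
place of the Lipschitz exponent `1` (LOCATE §4: the organ's sum re-runs with `θ_*^{β∕(2+β)}`; the Lipschitz upgrade is (ε), a sequel).  Proof: §2 at `m^K ≤ R < m^{K+1}`.
[folklore] [cite: Giaquinta1984, Ch. VI §1 Thm 1.1 pp.128–131, §3 Thm 3.2 p.137, Ch. III Lemma 2.1 p.86] -/
theorem smallRange_holder_law [FiniteDimensional ℝ V] (hd : 1 ≤ d) : ∃ ω₀ C : ℝ, 0 < ω₀ ∧ 0 < C ∧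
    ∀ (u : Zd d → V) (p : V) (x₀ : Zd d) (R : ℕ) (ω : ℝ), 1 ≤ R → ‖p‖ = 1 → 0 ≤ ω → ω ≤ ω₀ →
      (∀ y ∈ box x₀ (2 * (R : ℤ) + 1), ‖u y‖ = 1) → (∀ y ∈ box x₀ (2 * (R : ℤ) + 1), ‖u y - p‖ ≤ ω) →
      (∀ y ∈ box x₀ (2 * (R : ℤ)), ‖∑ μ, (u (y + unitVec μ) + u (y - unitVec μ))‖ • u y = ∑ μ, (u (y + unitVec μ) + u (y - unitVec μ))) →
      ∀ μ : Fin d, ‖u (x₀ + unitVec μ) - u x₀‖ ^ 2 ≤ C * ω ^ 2 / R := by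
  classical
  set A : ℝ := (2 : ℝ) ^ d * (1 + 56 * d) ^ d * (8 * ((d : ℝ) + 1)) ^ (d + 1) with hA
  have hA0 : 0 ≤ A := by positivity
  -- the integer ratio `m`
  set m : ℕ := ⌈8 * A * 2 ^ d + 4⌉₊ with hm
  have hmge : 8 * A * 2 ^ d + 4 ≤ (m : ℝ) := Nat.le_ceil _
  have h2d : (1 : ℝ) ≤ (2 : ℝ) ^ d := one_le_pow₀ (by norm_num)
  have hm4R : (4 : ℝ) ≤ m := by nlinarith
  have hm4 : 4 ≤ m := by exact_mod_cast hm4R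
  have hm0 : (0 : ℝ) < m := by linarith
  have hm2 : 2 ≤ m := by omega
  -- thresholds
  set ω₀ : ℝ := min 1 (((m : ℝ) ^ (d - 1))⁻¹ / (4 * (8 * A + 4))) with hω₀
  refine ⟨ω₀, 200 * d * (5 : ℝ) ^ d * m, by positivity, by positivity, ?_⟩
  intro u p x₀ R ω hR hp hω0 hωle hu1 hω hopt μ
  have hω1 : ω ≤ 1 := hωle.trans (min_le_left _ _)
  have hωsmall : ω ≤ ((m : ℝ) ^ (d - 1))⁻¹ / (4 * (8 * A + 4)) := hωle.trans (min_le_right _ _)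
  -- `m^K ≤ R < m^{K+1}`
  set K : ℕ := Nat.log m R with hK
  have hR0 : R ≠ 0 := by omega
  have hlow : m ^ K ≤ R := Nat.pow_log_le_self m hR0
  have hup : R < m ^ (K + 1) := Nat.lt_pow_succ_log_self (by omega) R
  have hlowZ : (m : ℤ) ^ K ≤ (R : ℤ) := by exact_mod_cast hlow
  -- §2 on the boxes `Q_{2m^K+1}(x₀) ⊆ Q_{2R+1}(x₀)`
  have hsub1 : box x₀ (2 * (m : ℤ) ^ K + 1) ⊆ box x₀ (2 * (R : ℤ) + 1) := box_mono x₀ (by linarith)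
  have hsub0 : box x₀ (2 * (m : ℤ) ^ K) ⊆ box x₀ (2 * (R : ℤ)) := box_mono x₀ (by linarith)
  have hmain := smallRange_energy_at_centre_le hd u p hp x₀ (m := m) (by rw [← hA]; exact hmge) K hω0 hω1 (by rw [← hA]; exact hωsmall)
    (fun y hy => hu1 y (hsub1 hy)) (fun y hy => hω y (hsub1 hy)) (fun y hy => hopt y (hsub0 hy))
  -- `(m^K)⁻¹ ≤ m∕R`
  have hRpos : (0 : ℝ) < R := by exact_mod_cast (show 0 < R by omega)
  have hmK0 : (0 : ℝ) < (m : ℝ) ^ K := by positivity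
  have hinv : ((m : ℝ) ^ K)⁻¹ ≤ (m : ℝ) / R := by
    rw [inv_eq_one_div, div_le_div_iff₀ hmK0 hRpos, one_mul]
    have : (R : ℝ) < (m : ℝ) ^ (K + 1) := by exact_mod_cast hup
    rw [pow_succ] at this
    linarith
  calc ‖u (x₀ + unitVec μ) - u x₀‖ ^ 2 ≤ ∑ ν, ‖u (x₀ + unitVec ν) - u x₀‖ ^ 2 :=
        Finset.single_le_sum (f := fun ν => ‖u (x₀ + unitVec ν) - u x₀‖ ^ 2) (fun _ _ => sq_nonneg _) (Finset.mem_univ μ)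
    _ ≤ 200 * d * (5 : ℝ) ^ d * ω ^ 2 * ((m : ℝ) ^ K)⁻¹ := hmain
    _ ≤ 200 * d * (5 : ℝ) ^ d * ω ^ 2 * ((m : ℝ) / R) := mul_le_mul_of_nonneg_left hinv (by positivity)
    _ = 200 * d * (5 : ℝ) ^ d * m * ω ^ 2 / R := by ring

end Summit.QuantumFields.YangMills.Theorems.PoincareLipschitzSphereMapSmallRangeHolder

end
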